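import Mathlib
import HarnessLib
import HarnessLib.Audit
import Summits.QuantumFields.Statement
import Literature.MathematicalPhysics.QuantumFieldTheory.LatticeLangevinDynamics

/-!
Route: NoiseSynchronisation

CLOSED (exhausted) 2026-08-17T10:04:12Z by planner-rbadge-QuantumFields-NoiseSynchronisat-8ceae4ff-g2-0 — reason: exhausted — note: route-repair g2 → CLOSE exhausted. CENSUS. Tried: (1) gen-0 retriage cruxes 4→2, Assembly wired into closes (bc6 stamp stale but moot now); (2) the rank-2 crux TwoPointSynchronisation (= thesis X) is dead twice: MISSTATED (A over all bounded measurable YMSpecies incl. indicator observables ⇒ no unif. The file is kept as the record of this route; refuted decls are indexed as negative knowledge (`ledger negatives`).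

# Route NoiseSynchronisation — the mass gap is a negative Lyapunov exponent — common-noise
synchronisation of the SZZ Langevin flow

It suffices to show X = TwoPointSynchronisation: for every compact simple G and faithful unitary
lattice representation r there is β₀ such that at every β ≥ β₀ the Shen–Zhu–Zhu Langevin dynamics of
Wilson's theory on the tori (ℤ/(2S+1))⁴ SYNCHRONISES UNDER COMMON NOISE, uniformly in the volume:
two strong solutions driven by the SAME Brownian noise from two INDEPENDENT μ_β-distributed starts
agree on every gauge-invariant local observable A in L¹ up to C_A e^(−γ(β)t), with one rate γ(β) > 0
and constants independent of S ≥ S₁(β) — the quenched (pathwise) statement that the top Lyapunov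
exponent of the flow's tangent cocycle is negative, volume-uniformly. X is stronger than the
weak-coupling lattice gap and is turned into it by two provable-grade items (LangevinFlow: the flow
exists for every compact G and leaves μ_β invariant; SynchronisationToClustering: quenched
forgetting + finite speed of propagation ⇒ volume-uniform exponential clustering in Euclidean time),
after which the shared existence leg ContinuumLegGivenGap (stmt-QuantumFields-15828) gives
YangMills. No idea card is realised (novel-route seat).
Lean: `TwoPointSynchronisation ∧ SynchronisationToClustering ∧ LangevinFlow ∧ ContinuumLegGivenGap`

## Assembly
Pure logic (theorem `closes` in Sketch.lean = glue.lean, sorry-free, axioms propext /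
Classical.choice / Quot.sound, lean check rc 0): fix a compact simple G and put the Borel σ-algebra
on it exactly as the Statement does (`letI := borel G`); ContinuumLegGivenGap reduces the G-clause
of YangMills to the UniformLatticeGap body for every faithful r; for such r, TwoPointSynchronisation
gives β₀ and, for β ≥ β₀, the synchronisation body, LangevinFlow gives the flow body at (r, β), and
SynchronisationToClustering turns the two into the clustering body — `refine hLeg G hG fun r => ?_;
obtain ⟨β₀, h⟩ := hSync G hG r; exact ⟨β₀, fun β hβ => hS2C G r β (hFlow G r β) (h β hβ)⟩`.

Rationale: WHY THIS LINE. New object for this problem: the random dynamical system generated by the SZZ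
stochastic quantisation (arXiv:2204.12737 §3) with COMMON noise — its two-point motion and the
tangent (derivative) cocycle J_t, whose top Lyapunov exponent at stationarity is λ = lim t⁻¹ E
log‖J_t‖ (Oseledets/Kingman; Furstenberg–Khasminskii: λ = −β∫HessS(v,v)dν, the sign of ONE ergodic
average against the canonical projective stationary measure, instead of a pointwise convexity bound
(Bakry–Émery, ShenZhuZhu2022, |β| < 1/48) or a sup over all test functions (Poincaré, routes
FradkinShenkerFlow / ConvexGribovBody)); imported area: random dynamical systems / multiplicative
ergodic theory / synchronisation by noise (FlandoliGessScheutzow2017, doi:10.1007/s00440-016-0716-2,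
BaxendaleHarris1986, doi:10.1007/978-1-4612-0451-0_9 (Baxendale: λ₁ < 0 + ellipticity ⇒ the
two-point motion synchronises), Furstenberg1963, LedrappierYoung1985) and coupling proofs of
spectral gaps for non-convex infinite-dimensional systems where functional inequalities are
unavailable (HairerMattingly2004, doi:10.1214/08-AOP392, HairerMattingly2011,
doi:10.1007/s00440-009-0250-6, Eberle2015). Why it is easier than it looks: (i) t ↦ E log‖J_t‖ is
SUBADDITIVE at stationarity, so ONE certified epoch t₀ with E log‖J_t₀‖_(∞→∞, mod gauge) ≤ −1 — a
finite-time, light-cone-local, stationary-averaged inequality with no boundary condition —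
self-improves to all times (Kingman, doi:10.1214/aop/1176996798); (ii) the strong-coupling end is
PROVED in substance: SZZ's Bakry–Émery constant K_S = Ric − β‖Hess‖ > 0 is exactly synchronous
contraction of the flow (von Renesse–Sturm, doi:10.1002/cpa.20060), so the line is a continuity of
the sign of a dynamical order parameter from |β| < 1/48 to β ≥ β₀; (iii) the lever sees the group:
for U(1) the Hessian of the Wilson action along the flow has no paramagnetic part and soft modes
relax at rate β⟨cos θ⟩k² → 0, λ = 0 exactly (Coulomb phase, no margin), while for non-abelian G the
zero-mean paramagnetic term −Re tr[C_p(v)A_p] (the tree's convexity-spent-at-β₁ identity)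
renormalises the soft-mode damping — the running coupling appears in the Lyapunov spectrum, a
dynamical RG. What it does that the listed routes and negatives do not: no listed route uses
dynamics as a certificate except through Bakry–Émery/localisation functional inequalities
(FradkinShenkerFlow's UP is an annealed L² statement; LangevinControlUV uses the Langevin noise for
a UV variational formula); here the certificate is quenched and pathwise, with a subadditive
structure none of them has; negatives index: 5 refuted statements, none near.

RANKED CRUXES. #2 TwoPointSynchronisation (crux) — for compact simple G and faithful r there is β₀
with: for every β ≥ β₀ there are γ > 0 and S₁ such that for every gauge-invariant local observable A
there is C with — on every torus of side 2S+1, S ≥ S₁, for every probability space carrying a flat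
link Brownian motion W and every jointly measurable family (U^x) of strong solutions of the SZZ
Langevin SDE from all starts x — ∫∫∫ |A(lift U^x_t) − A(lift U^y_t)| dμ_β(x) dμ_β(y) dP ≤ C e^(−γt)
for all t ≥ 0 (common-noise two-point synchronisation, volume-uniform). [difficulty: open-problem]
(why it might fail: λ_top ≥ 0 (noise-induced chaos from the O(√β) zero-mean paramagnetic Hessian),
slow global modes (torons / centre-flux sectors) at S ≲ ξ(β) spoiling S-uniformity, or a
weak-coupling massless phase for some G (then sync is algebraic): each kills the crux.)
[ShenZhuZhu2022, FlandoliGessScheutzow2017, doi:10.1007/978-1-4612-0451-0_9, Furstenberg1963,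
doi:10.1214/aop/1176996798, ChatterjeeYMProb2019]
#3 SynchronisationToClustering (crux) — for every compact G, lattice representation r and β: if the
SZZ flow exists from all starts, jointly measurably, and leaves μ_β invariant on every torus (the
LangevinFlow body), and two-point synchronisation holds with rate γ (the body of crux 2 at this β),
then there are m > 0 and S₁ such that every pair of gauge-invariant local observables clusters in
Euclidean time, |⟨A·τₙB⟩ − ⟨A⟩⟨B⟩| ≤ C(A,B) e^(−mn) on all tori S ≥ S₁, n ≤ S (stationarity:
Cov_μ(A,B∘τₙ) = Cov(A(U^x_t), B∘τₙ(U^x_t)); replace each factor by its noise-conditional mean, error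
C e^(−γt); finite speed localises the conditional means to disjoint light cones for 2vt < n;
independent Brownian families ⇒ m ≍ γ/v). [deps: TwoPointSynchronisation, LangevinFlow] [difficulty:
L] (why it might fail: the light cone of the continuous-time SDE is only (Cβt)^R/R!-sharp, so m ≲
γ/(eCβ) and the constants must survive Itô/Grönwall bookkeeping in the entrywise norm; translates of
B must reuse B's constant via translated noise — routine but unwritten for SDE flows on G^E.)
[ShenZhuZhu2022, MartinelliOlivieri1994, Martinelli1999, BergMaes1994, HairerMattingly2011]
#4 ContinuumLegGivenGap (crux) — SHARED existence leg (stmt-QuantumFields-15828, verbatim): for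
every compact simple G, IF for every faithful r the volume-uniform weak-coupling lattice gap holds
(UniformLatticeGap body, Borel σ-algebra), THEN there are r, a sequential scheme with β_k → ∞ and OS
data T with IsYangMillsFor, non-trivial and non-Gaussian tr F², T.HasMassGap Δ and HasLatticeMassGap
Δ. [deps: TwoPointSynchronisation] [difficulty: open-problem] (why it might fail: contains the joint
continuum limit with E0', E1 rotations and non-Gaussianity of tr F² (Bałaban gives stability, not
uniqueness/invariance); a lattice gap m(β) with ξ(β) bounded would make every weak-coupling limit
ultralocal.) [JaffeWitten2000, Balaban1989LargeFieldII, arXiv:1803.01950,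
OsterwalderSeilerAnnPhys1978, Literature.Barriers.QuantumFields.UVStabilityNonUniqueness,
Literature.Barriers.QuantumFields.FixedCouplingUltralocality]
#5 LangevinFlow (crux) — for EVERY compact group G, lattice representation r, coupling β, torus side
2S+1 and every probability space carrying a flat link Brownian motion there is a family (U^x) of
strong solutions of the SZZ Langevin SDE from all starts, jointly measurable in (start, ω), whose
transition operators leave the Wilson measure invariant (SZZ §3 well-posedness Lemma and Lemma 3.2,
printed for SO(N)/SU(N) in the defining representation; here for any closed ρ(G) ≤ U(N): polynomial
coefficients tangent to the compact ρ(G)^E, generator Σₑ Δₑ + ⟨∇𝒮ₑ,∇ₑ⟩ symmetric in L²(μ_β)).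
[difficulty: M] (why it might fail: only the SO(N)/SU(N)-defining case is printed (SZZ/SSZ); the
general closed-subgroup case, joint measurability of the strong-solution flow in the start and the
invariance need the Itô calculus of the tree's `IsItoIntegral` layer — unwritten, not doubtful.)
[ShenZhuZhu2022, ShenSmithZhu2024, arXiv:2204.12737]

TWO-LAYER PLAN. Foreseen glued splits (k ≤ 3, depth 1; nothing filed now). TwoPointSynchronisation ⇐
QuenchedForgetting (every trajectory approaches the noise-conditional mean in L¹(μ⊗P),
volume-uniform exponential rate; birth stub) → ForgettingToTwoPoint (Tonelli + triangle; birth stub)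
→ TwoPointSynchronisation; and, once the tangent flow of the SZZ SDE is a tree notion (definition
request below), QuenchedForgetting ⇐ OneEpochContraction (∃ t₀: E_(μ⊗P) log‖J_t₀‖_(∞→∞, mod gauge) ≤
−1, a light-cone-local finite-time inequality) → KingmanUpgrade (subadditivity at stationarity ⇒ λ ≤
−1/t₀) → LinearToNonlinear (Baxendale/Le Jan: λ < 0 + ellipticity of the link noise ⇒ two-point
synchronisation, localised by the light cone). SynchronisationToClustering ⇐ FiniteSpeed (Picard
light cone (Cβt)^R/R! for the SDE with nearest-neighbour polynomial drift; birth stub) →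
QuenchedDecoupling (birth stub). LangevinFlow ⇐ WellPosedMeasurable → Invariance (birth stubs). A
strong-coupling support StrongCouplingSynchronisation (|β| < β_SZZ: sync at rate K_S in the
Riemannian two-point distance, hence for every Lipschitz gauge-invariant observable) is provable
from SZZ's Bakry–Émery and is the natural first landing; not filed at open to keep the cone
crux-only.

KILL CRITERIA. ¬TwoPointSynchronisation by a POSITIVE top Lyapunov exponent — numerically: two
common-noise SZZ/heat-bath copies of SU(2) at a confined β (2.3–2.5) whose gauge-invariant plaquette
discrepancy does NOT decay on 8⁴–16⁴ (noise-induced chaos) — closes the route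
`refuted:TwoPointSynchronisation` and is a barrier candidate for the whole contraction/coupling
technique class on this summit. Decay that is exponential but with a rate shrinking with the torus
side at fixed β beyond S ≈ ξ(β) (slow global modes) forces a pivot: restate crux 2 for
contractible-support observables on S ≥ c·ξ(β) only (still enough for HasLatticeMassGap) or close
`exhausted`. A weak-coupling massless phase for some simple G refutes crux 2 and the summit's
lattice clause together. UniformLatticeGap proved by any other route moots cruxes 2, 3, 5 (close
`superseded`). ¬SynchronisationToClustering (sync holding while clustering fails) would mean finite
speed fails for the SDE — essentially impossible; treat as misstated and restate with the heat-bath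
chain.

NOT DECOMPOSED YET. The tangent flow / Lyapunov spectrum itself (needs a derivative-flow notion for
the tree's `LinkSDE`; definition request below), the one-epoch criterion and its Kingman upgrade,
the local (light-cone) version of Baxendale's λ₁ < 0 ⇒ synchronisation, the size of γ(β) (expected ≍
ξ(β)⁻², dynamic exponent z = 2; kept out of the Lean on purpose), the treatment of torons / centre
sectors on tori S ≲ ξ(β) (expected: heavy torelons make them fast for S ≫ ξ; for S ≲ ξ each
finite-dimensional flow synchronises at its own rate, the infimum over S being the bottleneck), the
heat-bath (discrete-time, exact light cone) twin of every item, and all k-uniform OS/continuum work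
(crux 4 is shared and has its own registered lines under Cruxes/ContinuumLegGivenGap).

CHEAPEST FALSIFIER. kit (not run by this planner seat; first job for a refuter, ≈ 10 core-hours):
SU(2) Wilson action, Kennedy–Pendleton heat bath (or Euler–Maruyama SZZ Langevin, dt = 0.01) on 8⁴,
12⁴, 16⁴ at β ∈ {1.0, 2.3, 2.5}; two copies from independent hot starts updated with IDENTICAL
random numbers / Brownian increments per link; measure D(t) = mean over plaquettes of |tr U_p − tr
U'_p|/2 and the 1×2-loop analogue versus sweeps. Expected if the line is alive: exponential decay of
D at β = 2.3, 2.5 with a rate roughly independent of the side once the side exceeds ≈ 2ξ(β), and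
fast decay at β = 1.0; control U(1) at β = 1.1 (Coulomb): decay rate falling like (2π/L)². Growth or
saturation of D at confined β kills crux 2 at once. Lookups done (this seat): no damage-spreading /
common-noise study of lattice gauge theory found (lit galaxy "damage spreading lattice gauge",
"synchronization by noise", "Lyapunov exponents lattice gauge": 0 relevant); SZZ's K_S > 0 gives
synchronisation for |β| < 1/(16(d−1)) = 1/48 (d = 4) by von Renesse–Sturm.

NUMBERS. SZZ Bakry–Émery window: |β| < 1/(16(d−1)) = 1/48 in d = 4 ('t Hooft normalisation,
arXiv:2204.12737 Thm 1.2) — there K_S > 0 is synchronous contraction at rate K_S. Expected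
weak-coupling scales (lattice units): soft-mode relaxation βk², hence finite-volume sync floor
β(2π/(2S+1))²; mass-induced floor γ(β) ≍ ξ(β)⁻² ~ e^(−2cβ) (z = 2); light-cone speed v ≲ eCβ per
unit time (Picard bound (Cβt)^R/R!); paramagnetic Hessian term O(β^(1/2)) with mean zero,
diamagnetic damping O(β) for localised tangent vectors (tree identity, card
convexity-spent-at-beta1). SU(2) reference couplings β = 2.3–2.5 (ξ ≈ 5–12). Items at open: 5 (4
cruxes incl. the shared leg and the provable-grade flow, 1 assembly); `closes` uses 4.

DEFINITION REQUESTS. Wanted for layer 2 (topic Literature/MathematicalPhysics/QuantumFieldTheory,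
after open): `LinkSDE.tangentFlow` — the derivative (first-variation) process J_t of a `LinkSDE`
solution family w.r.t. the start, as a linear cocycle on (𝔤)^E, with its Itô equation dJ = −β
HessS(U_t) J dt (the left-invariant noise is isometric); `lyapunovTop` — lim t⁻¹ E log‖J_t‖ at
stationarity for a submultiplicative gauge-covariant norm; and the heat-bath random-mapping twin
(one-link conditional law as the push-forward of Lebesgue measure, for the discrete-time
statements). Cite fact wanted: Kingman's subadditive ergodic theorem in the form `a_(s+t) ≤ a_s +
a_t ∘ θ_s, integrable ⇒ a_t/t → inf E a_t/t` (Mathlib has none; doi:10.1214/aop/1176996798). None is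
needed to elaborate the items filed now (all over LatticeLangevinDynamics / YangMillsOS / Mathlib).

Novelty: Searches (2026-08-17): lit frontier QuantumFields --since 2022 (60 rows; Langevin-on-YM: SZZ 2022
held, Langevin YM–Higgs CMP 2026 doi:10.1007/s00220-025-05528-7, Chevyrev–Shen 2D; nothing on
synchronisation or Lyapunov exponents); lit galaxy search --star all "synchronization by noise" (6
pdf hits: FGS AoP 2017, Homburg IFS, Gess–Yaroslavtsev; no lattice/gauge), "Lyapunov exponents
lattice gauge" (0), "two-point motion Langevin" (0), "damage spreading lattice gauge" / "damage
spreading SU(2)" / "damage healing gauge theory" (0 each), "plaquette random-cluster" (0); lit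
search remote "Cao Nissim Sheffield" (arXiv:2505.16585 read pp 1–3, arXiv:2509.04688: area law,
strong coupling only); local searchd unavailable all session (rc: ConnectionReset), OpenAlex 429;
tree: no Theses/Ideas of the summit mention synchronisation / Lyapunov / random dynamical systems
(grep); the 27 open routes' levers listed in NOTES (five words each); ledger negatives (5, none
near); mechhunt covered/exemplars digests read.
Nearest prior art found: ShenZhuZhu2022 (arXiv:2204.12737: the dynamics, Bakry–Émery K_S > 0 at |β|
< 1/48 ⇒ log-Sobolev, mass gap, uniqueness of the infinite-volume dynamics — by von Renesse–Sturm
this IS synchronous contraction, i.e. our crux 2 at strong coupling); FlandoliGessScheutzow2017 /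
doi:10.1007/s00440-016-0716-2 (synchronisation by noise for order-preserving or weakly contracting
RDS, finite-dimensional or monotone SPDE); route FradkinShenkerFlow (annealed heat-bath Poin  [refs: 10.1007/s00220-025-05528-7, 10.1007/s00440-016-0716-2, 2505.16585, 2509.04688, 2204.12737, doi:10.1007/s00220-025-05528-7, doi:10.1007/s00440-016-0716-2, ShenZhuZhu2022, FlandoliGessScheutzow2017]

Barriers (technique_class: random-dynamical-systems, synchronisation-by-noise): - technique_class: random-dynamical-systems, synchronisation-by-noise
- Literature.Barriers.QuantumFields.PerturbativeInvisibility: it does bite the MARGIN — γ(β) ≍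
e^(−2cβ) is flat in g, so no finite-order computation of the Furstenberg–Khasminskii average
certifies the sign; the bet is a sign/dichotomy argument (Kingman one-epoch + Baxendale λ₁ < 0 ⇒
sync) plus continuity from the proved strong-coupling end, never an estimate of ξ.
- Literature.Barriers.QuantumFields.StochasticQuantisationCriticality: evaded — the dynamics lives
on a FIXED lattice (SZZ's finite-dimensional SDE on ρ(G)^E at each spacing); no d = 4 SPDE solution
theory is invoked; the continuum limit is crux 4's, taken on correlation functions.
- Literature.Barriers.QuantumFields.AbelianDeconfinementD4: evaded structurally — for U(1) the
Wilson Hessian along the flow is purely diamagnetic, soft modes relax at βk²⟨cos θ⟩ and λ_top = 0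
(no margin, Coulomb phase), so the argument cannot be G-uniform; the non-abelian paramagnetic term
is where the group enters.
- Literature.Barriers.QuantumFields.U1GaussLawRateBound: consistent — a perimeter constant c forces
m ≤ 8c; crux 3 delivers m ≍ γ/v with γ non-perturbatively small, far below any 1/β-type perimeter
constant.
- Literature.Barriers.QuantumFields.UVStabilityNonUniqueness: hits crux 4 only (shared leg; the
sequential Statement form licenses subsequences, human ruling Y2).
- Literature.Barriers.QuantumFields.FixedCouplingUltralocality: hits crux 4 only (a_k mus

History (route lifecycle, newest last):
- 2026-08-17T10:04:12Z · CLOSED exhausted — exhausted (planner-rbadge-QuantumFields-NoiseSynchronisat-8ceae4ff-g2-0)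

sub-problem: YangMills · status: closed(exhausted) · opened planner-plan-novel-QuantumFields-YangMills-05f6363e-v2-g27-0 2026-08-17T08:36:56Z · rev 3 · ledger route-QuantumFields-NoiseSynchronisation
GENERATED by the gate from the ledger (D-0016/17). Provers cite these decls: `theorem foo : Summit.QuantumFields.YangMills.Theses.NoiseSynchronisation.<Decl> := …` in Summits/QuantumFields/YangMills/Theorems/<Name>.lean.
-/

namespace Summit.QuantumFields.YangMills.Theses.NoiseSynchronisation

open scoped BigOperators Topology Manifold Classical MeasureTheory ProbabilityTheory Matrix InnerProductSpace ComplexConjugate ContinuousMap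
open Filter Set Function TopologicalSpace MeasureTheory

attribute [summit_statement] _root_.YangMills

/-- item stmt-QuantumFields-17976 · crux · rank 2 · closed · moot by None · by planner
why it might fail: λ_top ≥ 0 (noise-induced chaos from the O(√β) zero-mean paramagnetic Hessian), slow global modes (torons / centre-flux sectors) at S ≲ ξ(β) spoiling S-uniformity, or a weak-coupling massless phase for some G (then sync is algebraic): each kills the crux.
sources: ShenZhuZhu2022, FlandoliGessScheutzow2017, doi:10.1007/978-1-4612-0451-0_9, Furstenberg1963, doi:10.1214/aop/1176996798, ChatterjeeYMProb2019
[crux] for compact simple G and faithful r there is β₀ with: for every β ≥ β₀ there are γ > 0 and S₁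
such that for every gauge-invariant local observable A there is C with — on every torus of side
2S+1, S ≥ S₁, for every probability space carrying a flat link Brownian motion W and every jointly
measurable family (U^x) of strong solutions of the SZZ Langevin SDE from all starts x — ∫∫∫ |A(lift
U^x_t) − A(lift U^y_t)| dμ_β(x) dμ_β(y) dP ≤ C e^(−γt) for all t ≥ 0 (common-noise two-point
synchronisation, volume-uniform). [difficulty: open-problem] -/
@[route_item "route-QuantumFields-NoiseSynchronisation"]
def TwoPointSynchronisation : Prop :=
  ∀ (G : Type) [Group G] [TopologicalSpace G] [IsTopologicalGroup G] [CompactSpace G] [MeasurableSpace G] [BorelSpace G], Literature.MathematicalPhysics.QuantumFieldTheory.IsCompactSimpleLieGroup G → ∀ (r : Literature.MathematicalPhysics.QuantumFieldTheory.LatticeRep G), ∃ β₀ : ℝ, ∀ β : ℝ, β₀ ≤ β → ∃ γ : ℝ, 0 < γ ∧ ∃ S₁ : ℕ, ∀ A : Literature.MathematicalPhysics.QuantumFieldTheory.YMSpecies G, ∃ C : ℝ, ∀ S : ℕ, S₁ ≤ S → ∀ (Ω : Type) [MeasurableSpace Ω] (P : MeasureTheory.Measure Ω) [MeasureTheory.IsProbabilityMeasure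 P] (W : NNReal → Ω → (Literature.MathematicalPhysics.QuantumFieldTheory.Edge 4 (2 * S + 1) × Literature.MathematicalPhysics.QuantumFieldTheory.NoiseIdx r.N → ℝ)) (hW : Literature.MathematicalPhysics.QuantumFieldTheory.IsFlatBrownian W P) (U : Literature.MathematicalPhysics.QuantumFieldTheory.GaugeConfig 4 (2 * S + 1) G → NNReal → Ω → Literature.MathematicalPhysics.QuantumFieldTheory.GaugeConfig 4 (2 * S + 1) G), (∀ x, (∀ ω, U x 0 ω = x) ∧ (Literature.MathematicalPhysics.QuantumFieldTheory.latticeLangevinDynamics (d := 4) (L := 2 * S + 1) r β).IsSolution r.ρ hW.natFiltration P W (U x)) → (∀ t, Measurable (fun p : Literature.MathematicalPhysics.QuantumFieldTheory.GaugeConfig 4 (2 * S + 1) G × Ω => U p.1 t p.2)) → ∀ t : NNReal, ∫ p, |A.F (Literature.MathematicalPhysics.QuantumLattice.torusLift (2 * S + 1) (U p.1 t p.2.2)) - A.F (Literature.MathematicalPhysics.QuantumLattice.torusLift (2 * S + 1) (U p.2.1 t p.2.2))| ∂((Literature.MathematicalPhysics.QuantumFieldTheory.wilsonMeasure (d :=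 4) (L := 2 * S + 1) r.ρ β).prod ((Literature.MathematicalPhysics.QuantumFieldTheory.wilsonMeasure (d := 4) (L := 2 * S + 1) r.ρ β).prod P)) ≤ C * Real.exp (-(γ * (t : ℝ)))

/-- item stmt-QuantumFields-15828 · crux · rank 4 · open · by operator
why it might fail: contains the joint continuum limit with E0', E1 rotations and non-Gaussianity of tr F² (Bałaban gives stability, not uniqueness/invariance); a lattice gap m(β) with ξ(β) bounded would make every weak-coupling limit ultralocal.
sources: JaffeWitten2000, Balaban1989LargeFieldII, arXiv:1803.01950, OsterwalderSeilerAnnPhys1978, Literature.Barriers.QuantumFields.UVStabilityNonUniqueness, Literature.Barriers.QuantumFields.FixedCouplingUltralocality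
[crux] (existence leg, RE-TYPED for the 2026-08-16 Statement) for every compact simple Lie group G:
IF for every faithful unitary r the volume-uniform weak-coupling lattice gap holds
(UniformLatticeGap body for G, Borel σ-algebra), THEN there are r, a sequential scheme sch WITH β_k
→ ∞ (`sch.HasWeakCouplingLimit`) and OS data T with IsYangMillsFor r sch T, T non-trivial and
non-Gaussian in tr F², and Δ > 0 with T.HasMassGap Δ ∧ HasLatticeMassGap r sch Δ. Intended use: a_k
∝ m(β_k) with β_k → ∞ (ξ(β) → ∞ is 2001-refereed and hub-filed: DirichletWindow /
XiCompleteMonotonicity), joint continuum limit with E0–E4 at that scale (Bałaban UV control, E1 by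
any of the hub's rotation routes), non-triviality from the curvature three/four-point function.
[deps: UniformLatticeGap] [difficulty: open-problem] -/
@[route_item "route-QuantumFields-NoiseSynchronisation"]
def ContinuumLegGivenGap : Prop :=
  ∀ (G : Type) [Group G] [TopologicalSpace G] [IsTopologicalGroup G] [CompactSpace G], Literature.MathematicalPhysics.QuantumFieldTheory.IsCompactSimpleLieGroup G → letI : MeasurableSpace G := borel G; haveI : BorelSpace G := ⟨rfl⟩; (∀ r : Literature.MathematicalPhysics.QuantumFieldTheory.LatticeRep G, ∃ β₀ : ℝ, ∀ β : ℝ, β₀ ≤ β → ∃ m : ℝ, 0 < m ∧ ∃ S₁ : ℕ, ∀ A B : Literature.MathematicalPhysics.QuantumFieldTheory.YMSpecies G, ∃ C : ℝ, ∀ S n : ℕ, S₁ ≤ S → n ≤ S → |Literature.MathematicalPhysics.QuantumFieldTheory.latticeConnectedCorr r.ρ β (2 * S + 1) A.F B.F n| ≤ C * Real.exp (-(m * n))) → ∃ (r : Literature.MathematicalPhysics.QuantumFieldTheory.LatticeRep G) (sch : Literature.MathematicalPhysics.QuantumFieldTheory.SpeciesScheme (Literature.MathematicalPhysics.QuantumFieldTheory.YMSpecies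 G)) (T : Literature.MathematicalPhysics.QuantumFieldTheory.OSData (Literature.MathematicalPhysics.QuantumFieldTheory.YMSpecies G) 4), sch.HasWeakCouplingLimit ∧ Literature.MathematicalPhysics.QuantumFieldTheory.IsYangMillsFor r sch T ∧ T.IsNontrivial r.curvature ∧ T.IsNonGaussian r.curvature ∧ ∃ Δ > 0, T.HasMassGap Δ ∧ Literature.MathematicalPhysics.QuantumFieldTheory.HasLatticeMassGap r sch Δ

/-- item stmt-QuantumFields-17977 · support · rank 3 · closed · moot by None · by planner
why it might fail: the light cone of the continuous-time SDE is only (Cβt)^R/R!-sharp, so m ≲ γ/(eCβ) and the constants must survive Itô/Grönwall bookkeeping in the entrywise norm; translates of B must reuse B's constant via translated noise — routine but unwritten for SDE flows on G^E.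
sources: ShenZhuZhu2022, MartinelliOlivieri1994, Martinelli1999, BergMaes1994, HairerMattingly2011
[crux] for every compact G, lattice representation r and β: if the SZZ flow exists from all starts,
jointly measurably, and leaves μ_β invariant on every torus (the LangevinFlow body), and two-point
synchronisation holds with rate γ (the body of crux 2 at this β), then there are m > 0 and S₁ such
that every pair of gauge-invariant local observables clusters in Euclidean time, |⟨A·τₙB⟩ − ⟨A⟩⟨B⟩|
≤ C(A,B) e^(−mn) on all tori S ≥ S₁, n ≤ S (stationarity: Cov_μ(A,B∘τₙ) = Cov(A(U^x_t),
B∘τₙ(U^x_t)); replace each factor by its noise-conditional mean, error C e^(−γt); finite speed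
localises the conditional means to disjoint light cones for 2vt < n; independent Brownian families ⇒
m ≍ γ/v). [deps: TwoPointSynchronisation, LangevinFlow] [difficulty: L] -/
@[route_item "route-QuantumFields-NoiseSynchronisation"]
def SynchronisationToClustering : Prop :=
  ∀ (G : Type) [Group G] [TopologicalSpace G] [IsTopologicalGroup G] [CompactSpace G] [MeasurableSpace G] [BorelSpace G], ∀ (r : Literature.MathematicalPhysics.QuantumFieldTheory.LatticeRep G) (β : ℝ), (∀ S : ℕ, ∀ (Ω : Type) [MeasurableSpace Ω] (P : MeasureTheory.Measure Ω) [MeasureTheory.IsProbabilityMeasure P] (W : NNReal → Ω → (Literature.MathematicalPhysics.QuantumFieldTheory.Edge 4 (2 * S + 1) × Literature.MathematicalPhysics.QuantumFieldTheory.NoiseIdx r.N → ℝ)) (hW : Literature.MathematicalPhysics.QuantumFieldTheory.IsFlatBrownian W P), ∃ U : Literature.MathematicalPhysics.QuantumFieldTheory.GaugeConfig 4 (2 * S + 1) G → NNReal → Ω → Literature.MathematicalPhysics.QuantumFieldTheory.GaugeConfig 4 (2 * S + 1) G, (∀ x, (∀ ω, U x 0 ω = x) ∧ (Literature.MathematicalPhysics.QuantumFieldTheory.latticeLangevinDynamics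 (d := 4) (L := 2 * S + 1) r β).IsSolution r.ρ hW.natFiltration P W (U x)) ∧ (∀ t, Measurable (fun p : Literature.MathematicalPhysics.QuantumFieldTheory.GaugeConfig 4 (2 * S + 1) G × Ω => U p.1 t p.2)) ∧ (∀ f : Literature.MathematicalPhysics.QuantumFieldTheory.GaugeConfig 4 (2 * S + 1) G → ℝ, Measurable f → (∃ M : ℝ, ∀ y, |f y| ≤ M) → ∀ t : NNReal, ∫ x, Literature.MathematicalPhysics.QuantumFieldTheory.markovTransition U P t f x ∂(Literature.MathematicalPhysics.QuantumFieldTheory.wilsonMeasure (d := 4) (L := 2 * S + 1) r.ρ β) = ∫ x, f x ∂(Literature.MathematicalPhysics.QuantumFieldTheory.wilsonMeasure (d := 4) (L := 2 * S + 1) r.ρ β))) → (∃ γ : ℝ, 0 < γ ∧ ∃ S₁ : ℕ, ∀ A : Literature.MathematicalPhysics.QuantumFieldTheory.YMSpecies G, ∃ C : ℝ, ∀ S : ℕ, S₁ ≤ S → ∀ (Ω : Type) [MeasurableSpace Ω] (P : MeasureTheory.Measure Ω) [MeasureTheory.IsProbabilityMeasure P] (W : NNReal → Ω → (Literature.MathematicalPhysics.QuantumFieldTheory.Edge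 4 (2 * S + 1) × Literature.MathematicalPhysics.QuantumFieldTheory.NoiseIdx r.N → ℝ)) (hW : Literature.MathematicalPhysics.QuantumFieldTheory.IsFlatBrownian W P) (U : Literature.MathematicalPhysics.QuantumFieldTheory.GaugeConfig 4 (2 * S + 1) G → NNReal → Ω → Literature.MathematicalPhysics.QuantumFieldTheory.GaugeConfig 4 (2 * S + 1) G), (∀ x, (∀ ω, U x 0 ω = x) ∧ (Literature.MathematicalPhysics.QuantumFieldTheory.latticeLangevinDynamics (d := 4) (L := 2 * S + 1) r β).IsSolution r.ρ hW.natFiltration P W (U x)) → (∀ t, Measurable (fun p : Literature.MathematicalPhysics.QuantumFieldTheory.GaugeConfig 4 (2 * S + 1) G × Ω => U p.1 t p.2)) → ∀ t : NNReal, ∫ p, |A.F (Literature.MathematicalPhysics.QuantumLattice.torusLift (2 * S + 1) (U p.1 t p.2.2)) - A.F (Literature.MathematicalPhysics.QuantumLattice.torusLift (2 * S + 1) (U p.2.1 t p.2.2))| ∂((Literature.MathematicalPhysics.QuantumFieldTheory.wilsonMeasure (d := 4) (L := 2 * S + 1) r.ρ β).prod ((Literature.MathematicalPhysics.QuantumFieldTheory.wilsonMeasure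 (d := 4) (L := 2 * S + 1) r.ρ β).prod P)) ≤ C * Real.exp (-(γ * (t : ℝ)))) → (∃ m : ℝ, 0 < m ∧ ∃ S₁ : ℕ, ∀ A B : Literature.MathematicalPhysics.QuantumFieldTheory.YMSpecies G, ∃ C : ℝ, ∀ S n : ℕ, S₁ ≤ S → n ≤ S → |Literature.MathematicalPhysics.QuantumFieldTheory.latticeConnectedCorr r.ρ β (2 * S + 1) A.F B.F n| ≤ C * Real.exp (-(m * n)))

/-- item stmt-QuantumFields-17978 · support · rank 5 · closed · moot by None · by planner
why it might fail: only the SO(N)/SU(N)-defining case is printed (SZZ/SSZ); the general closed-subgroup case, joint measurability of the strong-solution flow in the start and the invariance need the Itô calculus of the tree's `IsItoIntegral` layer — unwritten, not doubtful.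
sources: ShenZhuZhu2022, ShenSmithZhu2024, arXiv:2204.12737
[crux] for EVERY compact group G, lattice representation r, coupling β, torus side 2S+1 and every
probability space carrying a flat link Brownian motion there is a family (U^x) of strong solutions
of the SZZ Langevin SDE from all starts, jointly measurable in (start, ω), whose transition
operators leave the Wilson measure invariant (SZZ §3 well-posedness Lemma and Lemma 3.2, printed for
SO(N)/SU(N) in the defining representation; here for any closed ρ(G) ≤ U(N): polynomial coefficients
tangent to the compact ρ(G)^E, generator Σₑ Δₑ + ⟨∇𝒮ₑ,∇ₑ⟩ symmetric in L²(μ_β)). [difficulty: M] -/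
@[route_item "route-QuantumFields-NoiseSynchronisation"]
def LangevinFlow : Prop :=
  ∀ (G : Type) [Group G] [TopologicalSpace G] [IsTopologicalGroup G] [CompactSpace G] [MeasurableSpace G] [BorelSpace G], ∀ (r : Literature.MathematicalPhysics.QuantumFieldTheory.LatticeRep G) (β : ℝ), ∀ S : ℕ, ∀ (Ω : Type) [MeasurableSpace Ω] (P : MeasureTheory.Measure Ω) [MeasureTheory.IsProbabilityMeasure P] (W : NNReal → Ω → (Literature.MathematicalPhysics.QuantumFieldTheory.Edge 4 (2 * S + 1) × Literature.MathematicalPhysics.QuantumFieldTheory.NoiseIdx r.N → ℝ)) (hW : Literature.MathematicalPhysics.QuantumFieldTheory.IsFlatBrownian W P), ∃ U : Literature.MathematicalPhysics.QuantumFieldTheory.GaugeConfig 4 (2 * S + 1) G → NNReal → Ω → Literature.MathematicalPhysics.QuantumFieldTheory.GaugeConfig 4 (2 * S + 1) G, (∀ x, (∀ ω, U x 0 ω = x) ∧ (Literature.MathematicalPhysics.QuantumFieldTheory.latticeLangevinDynamics (d := 4) (L := 2 * S + 1) r β).IsSolution r.ρ hW.natFiltration P W (U x)) ∧ (∀ t,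 Measurable (fun p : Literature.MathematicalPhysics.QuantumFieldTheory.GaugeConfig 4 (2 * S + 1) G × Ω => U p.1 t p.2)) ∧ (∀ f : Literature.MathematicalPhysics.QuantumFieldTheory.GaugeConfig 4 (2 * S + 1) G → ℝ, Measurable f → (∃ M : ℝ, ∀ y, |f y| ≤ M) → ∀ t : NNReal, ∫ x, Literature.MathematicalPhysics.QuantumFieldTheory.markovTransition U P t f x ∂(Literature.MathematicalPhysics.QuantumFieldTheory.wilsonMeasure (d := 4) (L := 2 * S + 1) r.ρ β) = ∫ x, f x ∂(Literature.MathematicalPhysics.QuantumFieldTheory.wilsonMeasure (d := 4) (L := 2 * S + 1) r.ρ β))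

/-- item stmt-QuantumFields-17979 · assembly · rank 1 · closed · moot by None · by planner
sources: JaffeWitten2000, ShenZhuZhu2022
[assembly] TwoPointSynchronisation → SynchronisationToClustering → LangevinFlow →
ContinuumLegGivenGap → YangMills. -/
@[route_item "route-QuantumFields-NoiseSynchronisation"]
def Assembly : Prop :=
  TwoPointSynchronisation → SynchronisationToClustering → LangevinFlow → ContinuumLegGivenGap → YangMills

end Summit.QuantumFields.YangMills.Theses.NoiseSynchronisation
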